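import Summits.Ventures.GridStability.Models.DroopQVPortHamiltonianGains

/-!
# GridStability/Models/DroopQVPortHamiltonianFilters — the sharp solver-free lane is robust in ALL frequency-loop parameters: P–f gains AND both filter time constants of every unit

Cell `gridfusion` (LADDER-GRIDFUSION, APEX LINE rung G3.b; seat gridfusion-model-8 (g4); sequel of `Models/DroopQVPortHamiltonianGains.lean`). In the
port-Hamiltonian factorisation `J = (𝒥 − ℛ)𝒬` of the lossless droop+QV microgrid ([cite: ShinZavala2020, eqs. (10)–(12)], model
[cite: KunduEtAl2019, eqs. (4a)–(4c)]) the filter constants `τ_Qi` enter only the dissipation weights `k_Qi V_i/τ_Qi` of `ℛ`, and `(k_Pi, τ_Pi)` enter `𝒬`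
only through the decoupled frequency block `diag(τ_Pi/k_Pi)` (and `ℛ` through `k_Pi/τ_Pi² > 0`). Hence for the model `withGainsTau κ τ_P′ τ_Q′` (ALL `3n`
frequency-loop parameters replaced by arbitrary positive values; flows, set-points, rest points, `k_Q`, network unchanged) the Hessian pattern is the
congruence of the base one by `C = diag(1, d, 1)`, `d_i = √((τ_P′_i/κ_i)/(τ_Pi/k_Pi))` (`hessQ_withGainsTau_eq_conj`), so ONE certificate `𝒬 + c·r rᵀ ≻ 0`
at the printed parameters gives, for EVERY positive `(κ, τ_P′, τ_Q′)`: every complex eigenpair of the linearisation has `Re μ < 0` or is the rotation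
mode (`re_eig_neg_or_rotation_of_hessQ_withGainsTau`), with no Jordan chain at `0`. In swing-model terms (`M_i = τ_P′_i/κ_i`, `D_i = 1/κ_i`): EVERY positive
virtual inertia and damping of every unit — the sign form of the low-inertia question, certificate-free beyond the base PD fact. THREE COLUMNS. CERTIFIED
(kernel): matrix statements about MODEL N1 (MV-6N); no instance, no numbers, no rate; no sentence of this file says a converter or a microgrid is stable.
-/

noncomputable section

open Real Matrix Finset
open scoped ComplexOrder

namespace Summit.Ventures.GridStability.Models

namespace DroopMicrogrid

variable {n : ℕ} (mg : DroopMicrogrid n) (κ τP' τQ' : Fin n → ℝ)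

/-- **The same droop microgrid with ALL frequency-loop parameters replaced**: P–f gains `κ`, filter constants `τ_P′`, `τ_Q′` (per unit). [cite: KunduEtAl2019, eqs. (4b)–(4c)] -/
def withGainsTau : DroopMicrogrid n := { mg with kP := κ, τP := τP', τQ := τQ' }

/-- Data of `withGainsTau`. [folklore] -/
@[simp] theorem withGainsTau_kP : (mg.withGainsTau κ τP' τQ').kP = κ := rfl
/-- Data of `withGainsTau`. [folklore] -/
@[simp] theorem withGainsTau_τP : (mg.withGainsTau κ τP' τQ').τP = τP' := rfl
/-- Data of `withGainsTau`. [folklore] -/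
@[simp] theorem withGainsTau_τQ : (mg.withGainsTau κ τP' τQ').τQ = τQ' := rfl
/-- Data of `withGainsTau`. [folklore] -/
@[simp] theorem withGainsTau_kQ : (mg.withGainsTau κ τP' τQ').kQ = mg.kQ := rfl
/-- Data of `withGainsTau`. [folklore] -/
@[simp] theorem withGainsTau_Vset : (mg.withGainsTau κ τP' τQ').Vset = mg.Vset := rfl
/-- The sensitivity blocks do not read the frequency-loop parameters. [folklore] -/
@[simp] theorem withGainsTau_Pθ : (mg.withGainsTau κ τP' τQ').Pθ = mg.Pθ := rfl
/-- The sensitivity blocks do not read the frequency-loop parameters. [folklore] -/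
@[simp] theorem withGainsTau_PV : (mg.withGainsTau κ τP' τQ').PV = mg.PV := rfl
/-- The sensitivity blocks do not read the frequency-loop parameters. [folklore] -/
@[simp] theorem withGainsTau_Qθ : (mg.withGainsTau κ τP' τQ').Qθ = mg.Qθ := rfl
/-- The sensitivity blocks do not read the frequency-loop parameters. [folklore] -/
@[simp] theorem withGainsTau_QV : (mg.withGainsTau κ τP' τQ').QV = mg.QV := rfl

/-- **The steady states do not depend on the frequency-loop parameters.** [cite: KunduEtAl2019, after (5b)] -/
theorem withGainsTau_isSteadyState_iff (θs : Fin n → ℝ) : (mg.withGainsTau κ τP' τQ').IsSteadyState θs ↔ mg.IsSteadyState θs := Iff.rfl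

/-- **The rest point does not move.** [folklore] -/
theorem withGainsTau_field_eq_zero {θs : Fin n → ℝ} (h : mg.IsSteadyState θs) : (mg.withGainsTau κ τP' τQ').field (θs, 0, mg.Vset) = 0 :=
  (mg.withGainsTau κ τP' τQ').field_eq_zero_of_isSteadyState ((mg.withGainsTau_isSteadyState_iff κ τP' τQ' θs).2 h)

/-- The scaling vector `(1, d, 1)`, `d_i = √((τ_P′_i/κ_i)/(τ_Pi/k_Pi))`. [folklore] -/
def gtScaleVec : Fin n ⊕ (Fin n ⊕ Fin n) → ℝ :=
  Sum.elim (fun _ => (1 : ℝ)) (Sum.elim (fun i => Real.sqrt ((τP' i / κ i) / (mg.τP i / mg.kP i))) (fun _ => (1 : ℝ)))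

variable {κ τP' τQ'}

/-- All scaling entries are nonzero (positive base and new frequency blocks). [folklore] -/
theorem gtScaleVec_ne_zero (h0 : ∀ i, 0 < mg.τP i / mg.kP i) (h1 : ∀ i, 0 < τP' i / κ i) (a : Fin n ⊕ (Fin n ⊕ Fin n)) :
    mg.gtScaleVec κ τP' a ≠ 0 := by
  rcases a with i | i | i
  · simp [gtScaleVec]
  · simp only [gtScaleVec, Sum.elim_inr, Sum.elim_inl]
    exact (Real.sqrt_pos.2 (div_pos (h1 i) (h0 i))).ne'
  · simp [gtScaleVec]

/-- **The Hessian pattern of `withGainsTau` is the congruence `C·𝒬·C`**, `C = diag(1, d, 1)`. [cite: ShinZavala2020, eqs. (10)–(11)] -/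
theorem hessQ_withGainsTau_eq_conj (h0 : ∀ i, 0 < mg.τP i / mg.kP i) (h1 : ∀ i, 0 < τP' i / κ i) (θ V : Fin n → ℝ) :
    (mg.withGainsTau κ τP' τQ').hessQ θ V
      = (Matrix.diagonal (mg.gtScaleVec κ τP'))ᴴ * mg.hessQ θ V * Matrix.diagonal (mg.gtScaleVec κ τP') := by
  have key : ∀ i, Real.sqrt ((τP' i / κ i) / (mg.τP i / mg.kP i)) * (mg.τP i / mg.kP i) * Real.sqrt ((τP' i / κ i) / (mg.τP i / mg.kP i))
      = τP' i / κ i := by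
    intro i
    have hs : Real.sqrt ((τP' i / κ i) / (mg.τP i / mg.kP i)) * Real.sqrt ((τP' i / κ i) / (mg.τP i / mg.kP i))
        = (τP' i / κ i) / (mg.τP i / mg.kP i) := Real.mul_self_sqrt (div_pos (h1 i) (h0 i)).le
    have hne : mg.τP i / mg.kP i ≠ 0 := (h0 i).ne'
    calc Real.sqrt ((τP' i / κ i) / (mg.τP i / mg.kP i)) * (mg.τP i / mg.kP i) * Real.sqrt ((τP' i / κ i) / (mg.τP i / mg.kP i))
        = (Real.sqrt ((τP' i / κ i) / (mg.τP i / mg.kP i)) * Real.sqrt ((τP' i / κ i) / (mg.τP i / mg.kP i))) * (mg.τP i / mg.kP i) := by ring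
      _ = ((τP' i / κ i) / (mg.τP i / mg.kP i)) * (mg.τP i / mg.kP i) := by rw [hs]
      _ = τP' i / κ i := div_mul_cancel₀ _ hne
  rw [Matrix.diagonal_conjTranspose, star_trivial]
  ext a b
  rw [diagonal_mul_mul_diagonal_apply]
  rcases a with i | i | i <;> rcases b with j | j | j
  · simp [DroopMicrogrid.hessQ, block3, gtScaleVec]
  · simp [DroopMicrogrid.hessQ, block3, gtScaleVec]
  · simp [DroopMicrogrid.hessQ, block3, gtScaleVec]
  · simp [DroopMicrogrid.hessQ, block3, gtScaleVec]
  · simp only [DroopMicrogrid.hessQ, block3, Matrix.fromBlocks_apply₂₂, Matrix.fromBlocks_apply₁₁, gtScaleVec, Sum.elim_inr,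
      Sum.elim_inl, Matrix.diagonal_apply, withGainsTau_τP, withGainsTau_kP]
    by_cases h : i = j
    · subst h; simp only [if_true]; exact (key i).symm
    · simp [h]
  · simp [DroopMicrogrid.hessQ, block3, gtScaleVec]
  · simp [DroopMicrogrid.hessQ, block3, gtScaleVec]
  · simp [DroopMicrogrid.hessQ, block3, gtScaleVec]
  · simp [DroopMicrogrid.hessQ, block3, gtScaleVec]

/-- `C` fixes the rotation rank-one term. [folklore] -/
theorem gtScale_conj_vecMulVec_rot (c : ℝ) :
    (Matrix.diagonal (mg.gtScaleVec κ τP'))ᴴ * (c • Matrix.vecMulVec rot rot) * Matrix.diagonal (mg.gtScaleVec κ τP')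
      = c • Matrix.vecMulVec rot rot := by
  rw [Matrix.diagonal_conjTranspose, star_trivial]
  ext a b
  rw [diagonal_mul_mul_diagonal_apply]
  rcases a with i | i | i <;> rcases b with j | j | j <;> simp [rot, gtScaleVec, Matrix.vecMulVec_apply]

/-- **One certificate for all frequency-loop parameters**: `𝒬 + c·r rᵀ ≻ 0` for `mg` implies the same for `withGainsTau κ τ_P′ τ_Q′`. CERTIFIED. [folklore] -/
theorem hessQ_add_rankOne_posDef_withGainsTau (h0 : ∀ i, 0 < mg.τP i / mg.kP i) (h1 : ∀ i, 0 < τP' i / κ i) (θ V : Fin n → ℝ) {c : ℝ}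
    (hP : (mg.hessQ θ V + c • Matrix.vecMulVec rot rot).PosDef) :
    ((mg.withGainsTau κ τP' τQ').hessQ θ V + c • Matrix.vecMulVec rot rot).PosDef := by
  have hinj : Function.Injective (Matrix.diagonal (mg.gtScaleVec κ τP')).mulVec := by
    intro x y hxy
    funext a
    have h := congr_fun hxy a
    rw [Matrix.mulVec_diagonal, Matrix.mulVec_diagonal] at h
    exact mul_left_cancel₀ (mg.gtScaleVec_ne_zero h0 h1 a) h
  have h := hP.conjTranspose_mul_mul_same hinj
  rw [Matrix.mul_add, Matrix.add_mul, ← mg.hessQ_withGainsTau_eq_conj h0 h1, gtScale_conj_vecMulVec_rot] at h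
  exact h

/-- **Symmetry is inherited.** [folklore] -/
theorem hessQ_transpose_withGainsTau (h0 : ∀ i, 0 < mg.τP i / mg.kP i) (h1 : ∀ i, 0 < τP' i / κ i) (θ V : Fin n → ℝ)
    (hsymm : (mg.hessQ θ V)ᵀ = mg.hessQ θ V) :
    ((mg.withGainsTau κ τP' τQ').hessQ θ V)ᵀ = (mg.withGainsTau κ τP' τQ').hessQ θ V := by
  rw [mg.hessQ_withGainsTau_eq_conj h0 h1, Matrix.diagonal_conjTranspose, star_trivial, Matrix.transpose_mul, Matrix.transpose_mul, hsymm,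
    Matrix.diagonal_transpose, Matrix.mul_assoc]

/-- **THE SHARP SOLVER-FREE THEOREM, ROBUST IN ALL FREQUENCY-LOOP PARAMETERS (any `n`).** Base model with `k_Pi, τ_Pi > 0`, `k_Qi ≠ 0`, `k_Qi V_i > 0`,
`V_i ≠ 0`, symmetric `𝒬(θ, V)` and ONE certificate `𝒬(θ, V) + c·r rᵀ ≻ 0`; then for EVERY positive `κ, τ_P′, τ_Q′` (per unit: P–f gain and both filter
constants — every positive virtual inertia `τ_P′_i/κ_i` and damping `1/κ_i`), every complex eigenpair `(μ, v)` of `jacMatrix (withGainsTau κ τ_P′ τ_Q′) (θ, V)`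
has `Re μ < 0`, or `μ = 0` with `v ∈ ℂ·r`. CERTIFIED (matrix statement about MODEL N1, MV-6N; `3n` free parameters, no rate); [cite: ShinZavala2020, Prop. 1]
[cite: KunduEtAl2019, eqs. (4a)–(4c)]. No stability sentence. -/
theorem re_eig_neg_or_rotation_of_hessQ_withGainsTau (θ V : Fin n → ℝ) (hkP : ∀ i, 0 < mg.kP i) (hτP : ∀ i, 0 < mg.τP i)
    (hkQ : ∀ i, mg.kQ i ≠ 0) (hV : ∀ i, V i ≠ 0) (hQV : ∀ i, 0 < mg.kQ i * V i)
    (hsymm : (mg.hessQ θ V)ᵀ = mg.hessQ θ V) {c : ℝ} (hP : (mg.hessQ θ V + c • Matrix.vecMulVec rot rot).PosDef)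
    (hκ : ∀ i, 0 < κ i) (hτP' : ∀ i, 0 < τP' i) (hτQ' : ∀ i, 0 < τQ' i) {μ : ℂ} {v : Fin n ⊕ (Fin n ⊕ Fin n) → ℂ} (hv : v ≠ 0)
    (hJv : ((mg.withGainsTau κ τP' τQ').jacMatrix θ V).map ((↑) : ℝ → ℂ) *ᵥ v = μ • v) :
    μ.re < 0 ∨ (μ = 0 ∧ ∃ a : ℂ, v = fun k => a * ((rot k : ℝ) : ℂ)) := by
  have h0 : ∀ i, 0 < mg.τP i / mg.kP i := fun i => div_pos (hτP i) (hkP i)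
  have h1 : ∀ i, 0 < τP' i / κ i := fun i => div_pos (hτP' i) (hκ i)
  exact (mg.withGainsTau κ τP' τQ').re_eig_neg_or_rotation_of_hessQ θ V (fun i => (hκ i).ne') (fun i => (hτP' i).ne') hkQ hV
    (fun i => by rw [withGainsTau_kP, withGainsTau_τP]; exact div_pos (hκ i) (pow_pos (hτP' i) 2))
    (fun i => by rw [withGainsTau_kQ, withGainsTau_τQ]; exact div_pos (hQV i) (hτQ' i))
    (mg.hessQ_transpose_withGainsTau h0 h1 θ V hsymm) (mg.hessQ_add_rankOne_posDef_withGainsTau h0 h1 θ V hP) hv hJv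

/-- **No Jordan chain at the rotation zero, for all positive frequency-loop parameters** (structural). [folklore] -/
theorem no_jordan_chain_at_zero_of_hessQ_withGainsTau (θ V : Fin n → ℝ) (hkP : ∀ i, 0 < mg.kP i) (hτP : ∀ i, 0 < mg.τP i)
    (hkQ : ∀ i, mg.kQ i ≠ 0) (hV : ∀ i, V i ≠ 0) (hQV : ∀ i, 0 < mg.kQ i * V i)
    (hsymm : (mg.hessQ θ V)ᵀ = mg.hessQ θ V) (i₀ : Fin n) (hκ : ∀ i, 0 < κ i) (hτP' : ∀ i, 0 < τP' i) (hτQ' : ∀ i, 0 < τQ' i)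
    {w : Fin n ⊕ (Fin n ⊕ Fin n) → ℂ}
    (hw : ((mg.withGainsTau κ τP' τQ').jacMatrix θ V).map ((↑) : ℝ → ℂ) *ᵥ w = fun k => ((rot k : ℝ) : ℂ)) : False := by
  have h0 : ∀ i, 0 < mg.τP i / mg.kP i := fun i => div_pos (hτP i) (hkP i)
  have h1 : ∀ i, 0 < τP' i / κ i := fun i => div_pos (hτP' i) (hκ i)
  exact (mg.withGainsTau κ τP' τQ').no_jordan_chain_at_zero_of_hessQ θ V (fun i => (hκ i).ne') (fun i => (hτP' i).ne') hkQ hV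
    (fun i => by rw [withGainsTau_kP, withGainsTau_τP]; exact div_pos (hκ i) (pow_pos (hτP' i) 2))
    (fun i => by rw [withGainsTau_kQ, withGainsTau_τQ]; exact div_pos (hQV i) (hτQ' i))
    (mg.hessQ_transpose_withGainsTau h0 h1 θ V hsymm) i₀ hw

end DroopMicrogrid

end Summit.Ventures.GridStability.Models

end
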